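import Mathlib
import Literature.MathematicalPhysics.QuantumFieldTheory.OSReconstructionNoE1Proofs
import HarnessLib

/-!
# Universal two-point measure, III: the reference family of dilated bumps and the E0 growth bound
(line `complex-rotation-bandlimit`)

Support file for crux `stmt-QuantumFields-11686` (`PencilRigidity.NPointIsotropy`), stub
`universalTwoPointMeasure`. Two elementary inputs for the temperedness (and the strict positivity of
the normalising weight) of the universal two-point measure:

* `exists_seminorm_bound_sq` — **E0 as a quadratic bound**: for a one-species Schwinger family `S₁` on
  `ℝ⁴` with `h : OSReconstructionNoE1 S₁.toLabelled` there are finitely many Schwartz seminorms `q` and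
  `C` with `‖Ψ_u‖² ≤ C q(u)²` for every positive-time one-point `u ∈ 𝓢(ℝ⁴)` (one-point functions via
  `𝓢(ℝ⁴) ≅ 𝓢((ℝ⁴)¹)`): the sesquilinear form `(u, v) ↦ 𝔖₂(Θū ⊗ v)` is jointly continuous, hence bounded
  by `1` on a seminorm ball, hence quadratically bounded by scaling.
* `exists_reference_family` — **the reference family**: the dilates `u_n(a) = β((n+1)a)` of a smooth bump
  `β ≥ 0` supported in the unit ball around `(2, 0⃗)` are supported in `{a⁰ ≥ 1/(n+1)}`, have Laplace–Fourier
  transforms `û_n(p) = (n+1)⁻⁴ β̂(p/(n+1))` bounded below by `m (n+1)⁻⁴` on `{p₀ ≥ 0, ‖p‖ ≤ n+1}` (for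
  `‖q‖ ≤ 1`, `q₀ ≥ 0` the integrand of `Re β̂(q) = ∫ β(b) e^{-b⁰q₀} cos(b⃗·q⃗) db` is `≥ β e^{-3} cos 1`),
  uniformly bounded `L¹` norms, and Schwartz seminorms growing polynomially in `n` (chain rule for the
  linear dilation).

References: K. Osterwalder, R. Schrader, Comm. Math. Phys. 31 (1973) §4.1; folklore. [folklore]
-/

noncomputable section

namespace Summit.QuantumFields.YangMills.Theorems.NPointIsotropy.ComplexRotationBandlimit

open MeasureTheory Complex Set Filter Topology
open scoped InnerProductSpace ComplexConjugate SchwartzMap ENNReal NNReal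
open Literature.MathematicalPhysics.QuantumLattice Literature.MathematicalPhysics.AQFT
  Literature.MathematicalPhysics.QuantumFieldTheory

namespace UniversalTwoPoint

/-! ## E0 as a quadratic bound on one-point field vectors -/

variable {S₁ : SchwingerFamily (EuclideanSpace ℝ (Fin 4))} (h : OSReconstructionNoE1 S₁.toLabelled)

/-- `‖Ψ_F‖² = Re 𝔖₂(ΘF* ⊗ F)` for a time-ordered one-point `F`. [folklore] -/
theorem norm_fieldVec_one_sq {F : 𝓢((Fin 1 → (EuclideanSpace ℝ (Fin 4))), ℂ)} (hF : IsTimeOrdered F) :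
    ‖h.fieldVec 1 (fun _ => ()) F hF‖ ^ 2 = (S₁ (1 + 1) ((osAdjoint F).appendTensor F)).re := by
  rw [← inner_self_eq_norm_sq (𝕜 := ℂ),
    h.inner_fieldVec_fieldVec _ _ hF hF (isAppendTensorOf_appendTensor _ _)]
  rfl

/-- **E0 as a quadratic bound.** There are finitely many Schwartz seminorms `q = sup_{s} p_{k,l}` on `𝓢(ℝ⁴)`
and `C ≥ 0` with `‖Ψ_{toOne u}‖² ≤ C q(u)²` for every `u` with `toOne u` time-ordered. [folklore] -/
theorem exists_seminorm_bound_sq :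
    ∃ (s : Finset (ℕ × ℕ)) (C : ℝ), 0 ≤ C ∧ ∀ (u : 𝓢((EuclideanSpace ℝ (Fin 4)), ℂ)) (hu : IsTimeOrdered ((SchwartzMap.compCLMOfContinuousLinearEquiv ℂ (ContinuousLinearEquiv.funUnique (Fin 1) ℝ (EuclideanSpace ℝ (Fin 4)))) u)),
      ‖h.fieldVec 1 (fun _ => ()) ((SchwartzMap.compCLMOfContinuousLinearEquiv ℂ (ContinuousLinearEquiv.funUnique (Fin 1) ℝ (EuclideanSpace ℝ (Fin 4)))) u) hu‖ ^ 2 ≤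
        C * ((s.sup (schwartzSeminormFamily ℂ (EuclideanSpace ℝ (Fin 4)) ℂ)) u) ^ 2 := by
  -- the jointly continuous sesquilinear form `B(u, v) = 𝔖₂(Θ(toOne u)* ⊗ toOne v)` (kept opaque)
  obtain ⟨B, hB⟩ : ∃ B : 𝓢((EuclideanSpace ℝ (Fin 4)), ℂ) → 𝓢((EuclideanSpace ℝ (Fin 4)), ℂ) → ℂ,
      ∀ u v, B u v = S₁ (1 + 1) ((osAdjoint ((SchwartzMap.compCLMOfContinuousLinearEquiv ℂ (ContinuousLinearEquiv.funUnique (Fin 1) ℝ (EuclideanSpace ℝ (Fin 4)))) u)).appendTensor ((SchwartzMap.compCLMOfContinuousLinearEquiv ℂ (ContinuousLinearEquiv.funUnique (Fin 1) ℝ (EuclideanSpace ℝ (Fin 4)))) v)) := ⟨_, fun _ _ => rfl⟩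
  have hBc : Continuous fun z : 𝓢((EuclideanSpace ℝ (Fin 4)), ℂ) × 𝓢((EuclideanSpace ℝ (Fin 4)), ℂ) => B z.1 z.2 := by
    have heq : (fun z : 𝓢((EuclideanSpace ℝ (Fin 4)), ℂ) × 𝓢((EuclideanSpace ℝ (Fin 4)), ℂ) => B z.1 z.2) = fun z =>
        S₁ (1 + 1) ((osAdjoint ((SchwartzMap.compCLMOfContinuousLinearEquiv ℂ (ContinuousLinearEquiv.funUnique (Fin 1) ℝ (EuclideanSpace ℝ (Fin 4)))) z.1)).appendTensor ((SchwartzMap.compCLMOfContinuousLinearEquiv ℂ (ContinuousLinearEquiv.funUnique (Fin 1) ℝ (EuclideanSpace ℝ (Fin 4)))) z.2)) := funext fun z => hB _ _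
    rw [heq]
    exact (S₁ (1 + 1)).continuous.comp (continuous_appendTensor.comp
      ((continuous_osAdjoint.comp ((SchwartzMap.compCLMOfContinuousLinearEquiv ℂ _).continuous.comp
        continuous_fst)).prodMk
        ((SchwartzMap.compCLMOfContinuousLinearEquiv ℂ _).continuous.comp continuous_snd)))
  have hB0 : B 0 0 = 0 := by
    rw [hB, map_zero]
    have : ((osAdjoint (0 : 𝓢((Fin 1 → (EuclideanSpace ℝ (Fin 4))), ℂ))).appendTensor (0 : 𝓢((Fin 1 → (EuclideanSpace ℝ (Fin 4))), ℂ))) = 0 := by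
      ext x; simp
    rw [this, map_zero]
  have hBsmul : ∀ (c : ℂ) (u : 𝓢((EuclideanSpace ℝ (Fin 4)), ℂ)), B (c • u) (c • u) = conj c * c * B u u := by
    intro c u
    rw [hB, hB]
    simp only [map_smul, osAdjoint_smul, SchwartzMap.appendTensor_smul_left,
      SchwartzMap.appendTensor_smul_right, smul_eq_mul]
    ring
  -- a seminorm ball on which `|B| < 1`
  have hnhds : {z : 𝓢((EuclideanSpace ℝ (Fin 4)), ℂ) × 𝓢((EuclideanSpace ℝ (Fin 4)), ℂ) | ‖B z.1 z.2‖ < 1} ∈ 𝓝 ((0 : 𝓢((EuclideanSpace ℝ (Fin 4)), ℂ)), (0 : 𝓢((EuclideanSpace ℝ (Fin 4)), ℂ))) := by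
    refine (continuous_norm.comp hBc).isOpen_preimage _ isOpen_Iio |>.mem_nhds ?_
    show ‖B 0 0‖ < 1
    rw [hB0, norm_zero]; exact one_pos
  obtain ⟨U₁, hU₁, U₂, hU₂, hUU⟩ := mem_nhds_prod_iff.1 hnhds
  obtain ⟨s₁, r₁, hr₁, hs₁⟩ := (schwartz_withSeminorms ℂ (EuclideanSpace ℝ (Fin 4)) ℂ).mem_nhds_iff 0 U₁ |>.1 hU₁
  obtain ⟨s₂, r₂, hr₂, hs₂⟩ := (schwartz_withSeminorms ℂ (EuclideanSpace ℝ (Fin 4)) ℂ).mem_nhds_iff 0 U₂ |>.1 hU₂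
  set q := (s₁ ∪ s₂).sup (schwartzSeminormFamily ℂ (EuclideanSpace ℝ (Fin 4)) ℂ) with hq
  set r := min r₁ r₂ with hr
  have hr0 : 0 < r := lt_min hr₁ hr₂
  have hkey : ∀ u : 𝓢((EuclideanSpace ℝ (Fin 4)), ℂ), q u < r → ‖B u u‖ < 1 := by
    intro u hu
    have h1 : u ∈ U₁ := hs₁ (by
      rw [Seminorm.mem_ball_zero]
      exact lt_of_le_of_lt (Seminorm.le_def.1 (Finset.sup_mono Finset.subset_union_left) u)
        (hu.trans_le (min_le_left _ _)))
    have h2 : u ∈ U₂ := hs₂ (by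
      rw [Seminorm.mem_ball_zero]
      exact lt_of_le_of_lt (Seminorm.le_def.1 (Finset.sup_mono Finset.subset_union_right) u)
        (hu.trans_le (min_le_right _ _)))
    exact hUU (mk_mem_prod h1 h2)
  refine ⟨s₁ ∪ s₂, 4 / r ^ 2, by positivity, fun u hu => ?_⟩
  have hBuu : ‖B u u‖ ≤ 4 / r ^ 2 * (q u) ^ 2 := by
    rcases eq_or_lt_of_le (apply_nonneg q u) with hq0 | hqpos
    · -- `q u = 0`: `B u u = 0` by scaling with naturals
      rw [← hq0]
      have hall : ∀ n : ℕ, ((n : ℝ) + 1) ^ 2 * ‖B u u‖ < 1 := by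
        intro n
        have hsc := hkey ((((n : ℝ) + 1 : ℝ) : ℂ) • u) (by
          rw [map_smul_eq_mul, ← hq0, mul_zero]; exact hr0)
        rw [hBsmul, norm_mul, norm_mul, RCLike.norm_conj, Complex.norm_real,
          Real.norm_of_nonneg (by positivity)] at hsc
        nlinarith [hsc]
      have hz : ‖B u u‖ = 0 := by
        by_contra hne
        have hpos : 0 < ‖B u u‖ := lt_of_le_of_ne (norm_nonneg _) (Ne.symm hne)
        obtain ⟨n, hn⟩ := exists_nat_gt (1 / ‖B u u‖)
        have h1 := hall n
        have h2 : 1 / ‖B u u‖ < ((n : ℝ) + 1) ^ 2 := by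
          have : (n : ℝ) < (n : ℝ) + 1 := by linarith
          nlinarith
        rw [div_lt_iff₀ hpos] at h2
        linarith
      rw [hz]; positivity
    · -- `q u > 0`: scale to the ball of radius `r`
      set c : ℝ := r / (2 * q u) with hc
      have hc0 : 0 < c := by positivity
      have hsc := hkey (((c : ℝ) : ℂ) • u) (by
        rw [map_smul_eq_mul, Complex.norm_real, Real.norm_of_nonneg hc0.le, hc]
        field_simp
        linarith)
      rw [hBsmul, norm_mul, norm_mul, RCLike.norm_conj, Complex.norm_real,
        Real.norm_of_nonneg hc0.le] at hsc
      have hcq : c * q u = r / 2 := by rw [hc]; field_simp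
      have : c ^ 2 * ‖B u u‖ < 1 := by nlinarith [hsc]
      have hc2 : c ^ 2 = r ^ 2 / (4 * (q u) ^ 2) := by rw [hc]; field_simp; ring
      rw [hc2, div_mul_eq_mul_div, div_lt_one (by positivity)] at this
      rw [div_mul_eq_mul_div, le_div_iff₀ (by positivity)]
      linarith
  calc ‖h.fieldVec 1 (fun _ => ()) ((SchwartzMap.compCLMOfContinuousLinearEquiv ℂ (ContinuousLinearEquiv.funUnique (Fin 1) ℝ (EuclideanSpace ℝ (Fin 4)))) u) hu‖ ^ 2
      = (B u u).re := by rw [hB]; exact norm_fieldVec_one_sq h hu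
    _ ≤ ‖B u u‖ := (le_abs_self _).trans (Complex.abs_re_le_norm _)
    _ ≤ 4 / r ^ 2 * (q u) ^ 2 := hBuu

/-! ## The reference family of dilated bumps -/

omit h in
/-- Spatial Cauchy–Schwarz in coordinates: `(∑_{j≥1} bⱼ qⱼ)² ≤ ‖b − 2e₀‖² ‖q‖²`. [folklore] -/
theorem sq_sum_succ_mul_le (b q : (EuclideanSpace ℝ (Fin 4))) :
    (∑ j : Fin 3, b j.succ * q j.succ) ^ 2 ≤ ‖b - EuclideanSpace.single 0 (2 : ℝ)‖ ^ 2 * ‖q‖ ^ 2 := by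
  refine (Finset.sum_mul_sq_le_sq_mul_sq _ _ _).trans ?_
  have h1 : ∑ j : Fin 3, b j.succ ^ 2 ≤ ‖b - EuclideanSpace.single 0 (2 : ℝ)‖ ^ 2 := by
    rw [EuclideanSpace.norm_sq_eq]
    conv_rhs => rw [Fin.sum_univ_succ]
    simp only [PiLp.sub_apply, PiLp.single_apply, Fin.succ_ne_zero, if_false, sub_zero,
      Real.norm_eq_abs, sq_abs, if_true]
    linarith [sq_nonneg (b 0 - 2)]
  have h2 : ∑ j : Fin 3, q j.succ ^ 2 ≤ ‖q‖ ^ 2 := by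
    rw [EuclideanSpace.norm_sq_eq]
    conv_rhs => rw [Fin.sum_univ_succ]
    simp only [Real.norm_eq_abs, sq_abs]
    linarith [sq_nonneg (q 0)]
  exact mul_le_mul h1 h2 (Finset.sum_nonneg fun j _ => sq_nonneg _) (sq_nonneg _)

omit h in
/-- **Lower bound for the transform of a bump near `(2, 0⃗)`**: for `β ≥ 0` supported in the unit ball
around `2e₀` and `q` with `q₀ ≥ 0`, `‖q‖ ≤ 1`, `Re ∫ β(b) e^{-b⁰q₀ + ib⃗·q⃗} db ≥ (e⁻³/2) ∫ β`. [folklore] -/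
theorem integral_bump_mul_kernel_re_ge (β : ContDiffBump (EuclideanSpace.single 0 (2 : ℝ) : (EuclideanSpace ℝ (Fin 4))))
    (hβ : β.rOut = 1) {q : (EuclideanSpace ℝ (Fin 4))} (hq0 : 0 ≤ q 0) (hq : ‖q‖ ≤ 1) :
    Real.exp (-3) / 2 * ∫ b, β b ≤
      (∫ b, ((β b : ℝ) : ℂ) * cexp (-((b 0 * q 0 : ℝ) : ℂ) +
        ((∑ j : Fin 3, b j.succ * q j.succ : ℝ) : ℂ) * I)).re := by
  have hint : Integrable (fun b : (EuclideanSpace ℝ (Fin 4)) => ((β b : ℝ) : ℂ) * cexp (-((b 0 * q 0 : ℝ) : ℂ) +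
      ((∑ j : Fin 3, b j.succ * q j.succ : ℝ) : ℂ) * I)) := by
    refine Continuous.integrable_of_hasCompactSupport (by
      have := β.continuous; fun_prop) ?_
    exact (β.hasCompactSupport.comp_left (g := fun r : ℝ => (r : ℂ)) Complex.ofReal_zero).mul_right
  have hre := integral_re hint
  simp only [RCLike.re_eq_complex_re] at hre
  rw [← hre, ← integral_const_mul]
  refine integral_mono ((β.integrable).const_mul _) hint.re (fun b => ?_)
  simp only [Complex.re_ofReal_mul, Complex.exp_re]
  have him : (-((b 0 * q 0 : ℝ) : ℂ) + ((∑ j : Fin 3, b j.succ * q j.succ : ℝ) : ℂ) * I).im =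
      ∑ j : Fin 3, b j.succ * q j.succ := by simp
  have hre' : (-((b 0 * q 0 : ℝ) : ℂ) + ((∑ j : Fin 3, b j.succ * q j.succ : ℝ) : ℂ) * I).re =
      -(b 0 * q 0) := by simp
  rw [him, hre']
  by_cases hb : β b = 0
  · rw [hb]; simp
  have hball : b ∈ Metric.ball (EuclideanSpace.single 0 (2 : ℝ) : (EuclideanSpace ℝ (Fin 4))) 1 := by
    rw [← hβ, ← β.support_eq]; exact hb
  rw [Metric.mem_ball, dist_eq_norm] at hball
  -- time component: `1 < b⁰ < 3`
  have hb0 : |b 0 - 2| < 1 := by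
    have := PiLp.norm_apply_le (b - EuclideanSpace.single 0 (2 : ℝ)) 0
    simp only [PiLp.sub_apply, PiLp.single_apply, if_true, Real.norm_eq_abs] at this
    exact this.trans_lt hball
  have hq0' : q 0 ≤ 1 := by
    have := PiLp.norm_apply_le q 0
    rw [Real.norm_eq_abs] at this
    exact (le_abs_self _).trans (this.trans hq)
  have hexp : Real.exp (-3) ≤ Real.exp (-(b 0 * q 0)) := by
    rw [Real.exp_le_exp]
    have : b 0 * q 0 ≤ 3 * 1 := by
      refine mul_le_mul ?_ hq0' hq0 (by norm_num)
      linarith [(abs_lt.1 hb0).2]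
    linarith
  -- spatial phase: `|b⃗·q⃗| ≤ 1`, so `cos ≥ cos 1 ≥ 1/2`
  have hphase : |∑ j : Fin 3, b j.succ * q j.succ| ≤ 1 := by
    rw [← sq_le_one_iff_abs_le_one]
    refine (sq_sum_succ_mul_le b q).trans ?_
    have h1 : ‖b - EuclideanSpace.single 0 (2 : ℝ)‖ ^ 2 ≤ 1 := by
      rw [sq_le_one_iff_abs_le_one, abs_of_nonneg (norm_nonneg _)]; exact hball.le
    have h2 : ‖q‖ ^ 2 ≤ 1 := by
      rw [sq_le_one_iff_abs_le_one, abs_of_nonneg (norm_nonneg _)]; exact hq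
    nlinarith [sq_nonneg ‖q‖]
  have hcos : 1 / 2 ≤ Real.cos (∑ j : Fin 3, b j.succ * q j.succ) := by
    rw [← Real.cos_abs, ← Real.cos_pi_div_three]
    refine Real.cos_le_cos_of_nonneg_of_le_pi (abs_nonneg _) ?_ (hphase.trans ?_) <;>
      linarith [Real.pi_gt_three]
  have hβ0 : 0 ≤ β b := β.nonneg
  calc Real.exp (-3) / 2 * β b = β b * (Real.exp (-3) * (1 / 2)) := by ring
    _ ≤ β b * (Real.exp (-(b 0 * q 0)) * Real.cos (∑ j : Fin 3, b j.succ * q j.succ)) := by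
        gcongr
    _ = _ := by ring

omit h in
/-- **The reference family.** Dilates `u_n(a) = β((n+1)a)` of a bump at `2e₀`: supported in
`{a⁰ ≥ 1/(n+1)}`, transforms bounded below by `m (n+1)⁻⁴` on `{p₀ ≥ 0, ‖p‖ ≤ n+1}`, uniformly
`L¹`-bounded, Schwartz seminorms of polynomial growth in `n`. [folklore] -/
theorem exists_reference_family :
    ∃ (u : ℕ → 𝓢((EuclideanSpace ℝ (Fin 4)), ℂ)) (m : ℝ), 0 < m ∧
      (∀ n a, u n a ≠ 0 → ((n : ℝ) + 1)⁻¹ ≤ a 0) ∧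
      (∀ (n : ℕ) (p : (EuclideanSpace ℝ (Fin 4))), 0 ≤ p 0 → ‖p‖ ≤ (n : ℝ) + 1 →
        m ≤ ((n : ℝ) + 1) ^ 4 * ‖∫ a, u n a * cexp (-((a 0 * p 0 : ℝ) : ℂ) +
          ((∑ j : Fin 3, a j.succ * p j.succ : ℝ) : ℂ) * I)‖) ∧
      (∃ I₀ : ℝ, ∀ n, ∫ a, ‖u n a‖ ≤ I₀) ∧
      (∀ s : Finset (ℕ × ℕ), ∃ (C : ℝ) (L : ℕ), ∀ n,
        (s.sup (schwartzSeminormFamily ℂ (EuclideanSpace ℝ (Fin 4)) ℂ)) (u n) ≤ C * ((n : ℝ) + 1) ^ L) := by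
  set c₀ : (EuclideanSpace ℝ (Fin 4)) := EuclideanSpace.single 0 (2 : ℝ) with hc₀
  let β : ContDiffBump c₀ := ⟨1 / 2, 1, by norm_num, by norm_num⟩
  have hβr : β.rOut = 1 := rfl
  -- the base function and its dilates
  set bfun : (EuclideanSpace ℝ (Fin 4)) → ℂ := fun a => ((β a : ℝ) : ℂ) with hbfun
  have hb_smooth : ContDiff ℝ ((⊤ : ℕ∞) : WithTop ℕ∞) bfun := Complex.ofRealCLM.contDiff.comp β.contDiff
  have hb_supp : HasCompactSupport bfun :=
    β.hasCompactSupport.comp_left (g := fun r : ℝ => (r : ℂ)) Complex.ofReal_zero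
  have hR : ∀ n : ℕ, (0 : ℝ) < (n : ℝ) + 1 := fun n => by positivity
  have hR1 : ∀ n : ℕ, (1 : ℝ) ≤ (n : ℝ) + 1 := fun n => by linarith [(n.cast_nonneg : (0 : ℝ) ≤ n)]
  have hsupp : ∀ n : ℕ, HasCompactSupport fun a : (EuclideanSpace ℝ (Fin 4)) => bfun (((n : ℝ) + 1) • a) := fun n =>
    hb_supp.comp_homeomorph (Homeomorph.smulOfNeZero ((n : ℝ) + 1) (hR n).ne')
  have hsmooth : ∀ n : ℕ, ContDiff ℝ ((⊤ : ℕ∞) : WithTop ℕ∞) fun a : (EuclideanSpace ℝ (Fin 4)) => bfun (((n : ℝ) + 1) • a) :=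
    fun n => hb_smooth.comp (contDiff_const_smul _)
  set u : ℕ → 𝓢((EuclideanSpace ℝ (Fin 4)), ℂ) := fun n => (hsupp n).toSchwartzMap (hsmooth n) with hu
  have hu_apply : ∀ n a, u n a = ((β (((n : ℝ) + 1) • a) : ℝ) : ℂ) := fun n a => rfl
  set u₀ : 𝓢((EuclideanSpace ℝ (Fin 4)), ℂ) := hb_supp.toSchwartzMap hb_smooth with hu₀
  have hu₀_apply : ∀ a, u₀ a = bfun a := fun a => rfl
  -- support of β
  have hball : ∀ b : (EuclideanSpace ℝ (Fin 4)), β b ≠ 0 → ‖b - c₀‖ < 1 := by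
    intro b hb
    have : b ∈ Metric.ball c₀ β.rOut := by rw [← β.support_eq]; exact hb
    rwa [Metric.mem_ball, dist_eq_norm] at this
  set m : ℝ := Real.exp (-3) / 2 * ∫ b, β b with hm
  have hm0 : 0 < m := by rw [hm]; exact mul_pos (by positivity) β.integral_pos
  refine ⟨u, m, hm0, ?_, ?_, ?_, ?_⟩
  · -- support in `{a⁰ ≥ 1/(n+1)}`
    intro n a ha
    rw [hu_apply] at ha
    have hβ : β (((n : ℝ) + 1) • a) ≠ 0 := fun h0 => ha (by rw [h0]; simp)
    have h1 := hball _ hβ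
    have h2 : |((n : ℝ) + 1) * a 0 - 2| < 1 := by
      have := PiLp.norm_apply_le ((((n : ℝ) + 1) • a) - c₀) 0
      simp only [hc₀, PiLp.sub_apply, PiLp.smul_apply, PiLp.single_apply, if_true, smul_eq_mul,
        Real.norm_eq_abs] at this
      exact this.trans_lt h1
    have h3 : 1 < ((n : ℝ) + 1) * a 0 := by linarith [(abs_lt.1 h2).1]
    rw [inv_le_iff_one_le_mul₀ (hR n), mul_comm]
    exact h3.le
  · -- lower bound on the transform
    intro n p hp0 hp
    have hRpos : (0 : ℝ) < (n : ℝ) + 1 := hR n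
    -- change of variables `a = (n+1)⁻¹ b`
    have hcov : (∫ a, u n a * cexp (-((a 0 * p 0 : ℝ) : ℂ) +
        ((∑ j : Fin 3, a j.succ * p j.succ : ℝ) : ℂ) * I)) =
        (((((n : ℝ) + 1) ^ 4)⁻¹ : ℝ) : ℂ) * ∫ b, ((β b : ℝ) : ℂ) *
          cexp (-((b 0 * ((((n : ℝ) + 1)⁻¹) • p) 0 : ℝ) : ℂ) +
          ((∑ j : Fin 3, b j.succ * ((((n : ℝ) + 1)⁻¹) • p) j.succ : ℝ) : ℂ) * I) := by
      have key := Measure.integral_comp_smul (volume : Measure (EuclideanSpace ℝ (Fin 4)))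
        (fun b : (EuclideanSpace ℝ (Fin 4)) => ((β b : ℝ) : ℂ) * cexp (-((b 0 * ((((n : ℝ) + 1)⁻¹) • p) 0 : ℝ) : ℂ) +
          ((∑ j : Fin 3, b j.succ * ((((n : ℝ) + 1)⁻¹) • p) j.succ : ℝ) : ℂ) * I)) ((n : ℝ) + 1)
      rw [finrank_euclideanSpace, Fintype.card_fin, abs_of_nonneg (by positivity)] at key
      rw [← Complex.real_smul, ← key]
      refine integral_congr_ae (Eventually.of_forall fun a => ?_)
      have e1 : (((n : ℝ) + 1) • a) 0 * ((((n : ℝ) + 1)⁻¹) • p) 0 = a 0 * p 0 := by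
        simp only [PiLp.smul_apply, smul_eq_mul]; field_simp
      have e2 : (∑ j : Fin 3, (((n : ℝ) + 1) • a) j.succ * ((((n : ℝ) + 1)⁻¹) • p) j.succ) =
          ∑ j : Fin 3, a j.succ * p j.succ := by
        refine Finset.sum_congr rfl fun j _ => ?_
        simp only [PiLp.smul_apply, smul_eq_mul]; field_simp
      beta_reduce
      rw [e1, e2, hu_apply]
    have hq0 : 0 ≤ ((((n : ℝ) + 1)⁻¹) • p) 0 := by
      rw [PiLp.smul_apply, smul_eq_mul]; positivity
    have hq : ‖(((n : ℝ) + 1)⁻¹) • p‖ ≤ 1 := by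
      rw [norm_smul, Real.norm_of_nonneg (by positivity), inv_mul_le_iff₀ hRpos, mul_one]
      exact hp
    have hlow := integral_bump_mul_kernel_re_ge β hβr hq0 hq
    rw [hcov, norm_mul, Complex.norm_real, Real.norm_of_nonneg (by positivity), ← mul_assoc,
      mul_inv_cancel₀ (by positivity), one_mul]
    exact hlow.trans (Complex.re_le_norm _)
  · -- uniform `L¹` bound
    refine ⟨∫ b, β b, fun n => ?_⟩
    set R : ℝ := (n : ℝ) + 1 with hRdef
    have key := Measure.integral_comp_smul (volume : Measure (EuclideanSpace ℝ (Fin 4))) (fun b : (EuclideanSpace ℝ (Fin 4)) => β b) R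
    rw [finrank_euclideanSpace, Fintype.card_fin, abs_of_nonneg (by positivity), smul_eq_mul] at key
    have h1 : (∫ a, ‖u n a‖) = ∫ a, β (R • a) := by
      refine integral_congr_ae (Eventually.of_forall fun a => ?_)
      beta_reduce
      rw [hu_apply, Complex.norm_real, Real.norm_of_nonneg β.nonneg]
    rw [h1, key]
    have hI : 0 ≤ ∫ b, β b := β.integral_pos.le
    have hR4 : (R ^ 4)⁻¹ ≤ 1 := inv_le_one_of_one_le₀ (one_le_pow₀ (hR1 n))
    nlinarith
  · -- polynomial growth of seminorms
    intro s
    set L : ℕ := s.sup fun m => m.2 with hL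
    set C : ℝ := ∑ m ∈ s, SchwartzMap.seminorm ℂ m.1 m.2 u₀ with hC
    have hC0 : 0 ≤ C := Finset.sum_nonneg fun m _ => apply_nonneg _ _
    refine ⟨C, L, fun n => ?_⟩
    set R : ℝ := (n : ℝ) + 1 with hRdef
    have hRge : 1 ≤ R := hR1 n
    refine Seminorm.finset_sup_apply_le (by positivity) fun m hm => ?_
    have hml : m.2 ≤ L := Finset.le_sup (f := fun m : ℕ × ℕ => m.2) hm
    have hsem : SchwartzMap.seminorm ℂ m.1 m.2 (u n) ≤ R ^ m.2 * SchwartzMap.seminorm ℂ m.1 m.2 u₀ := by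
      refine SchwartzMap.seminorm_le_bound ℂ m.1 m.2 (u n) (by positivity) fun a => ?_
      have hcomp : ⇑(u n) = bfun ∘ ⇑(R • ContinuousLinearMap.id ℝ (EuclideanSpace ℝ (Fin 4))) := by
        funext a; rfl
      rw [hcomp, ContinuousLinearMap.iteratedFDeriv_comp_right _ hb_smooth a (mod_cast le_top)]
      have hnorm : ‖R • ContinuousLinearMap.id ℝ (EuclideanSpace ℝ (Fin 4))‖ ≤ R := by
        rw [norm_smul, Real.norm_of_nonneg (by positivity)]
        exact mul_le_of_le_one_right (by positivity) ContinuousLinearMap.norm_id_le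
      calc ‖a‖ ^ m.1 * ‖(iteratedFDeriv ℝ m.2 bfun ((R • ContinuousLinearMap.id ℝ (EuclideanSpace ℝ (Fin 4))) a)).compContinuousLinearMap
              fun _ => R • ContinuousLinearMap.id ℝ (EuclideanSpace ℝ (Fin 4))‖
          ≤ ‖a‖ ^ m.1 * (‖iteratedFDeriv ℝ m.2 bfun ((R • ContinuousLinearMap.id ℝ (EuclideanSpace ℝ (Fin 4))) a)‖ *
              ∏ _i : Fin m.2, ‖R • ContinuousLinearMap.id ℝ (EuclideanSpace ℝ (Fin 4))‖) := by
            gcongr; exact ContinuousMultilinearMap.norm_compContinuousLinearMap_le _ _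
        _ ≤ ‖R • a‖ ^ m.1 * (‖iteratedFDeriv ℝ m.2 bfun (R • a)‖ * R ^ m.2) := by
            rw [Finset.prod_const, Finset.card_univ, Fintype.card_fin]
            have h1 : ‖a‖ ≤ ‖R • a‖ := by
              rw [norm_smul, Real.norm_of_nonneg (by positivity)]
              exact le_mul_of_one_le_left (norm_nonneg _) hRge
            gcongr
            · rfl
        _ = R ^ m.2 * (‖R • a‖ ^ m.1 * ‖iteratedFDeriv ℝ m.2 bfun (R • a)‖) := by ring
        _ ≤ R ^ m.2 * SchwartzMap.seminorm ℂ m.1 m.2 u₀ := by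
            have hle := SchwartzMap.le_seminorm ℂ m.1 m.2 u₀ (R • a)
            change ‖R • a‖ ^ m.1 * ‖iteratedFDeriv ℝ m.2 bfun (R • a)‖ ≤ _ at hle
            gcongr
    calc schwartzSeminormFamily ℂ (EuclideanSpace ℝ (Fin 4)) ℂ m (u n) = SchwartzMap.seminorm ℂ m.1 m.2 (u n) := rfl
      _ ≤ R ^ m.2 * SchwartzMap.seminorm ℂ m.1 m.2 u₀ := hsem
      _ ≤ R ^ L * C :=
          mul_le_mul (pow_le_pow_right₀ hRge hml)
            (Finset.single_le_sum (f := fun m : ℕ × ℕ => SchwartzMap.seminorm ℂ m.1 m.2 u₀)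
              (fun _ _ => apply_nonneg _ _) hm) (apply_nonneg _ _) (by positivity)
      _ = C * R ^ L := mul_comm _ _

end UniversalTwoPoint

/-- **The reference family of dilated bumps** (closed form of `UniversalTwoPoint.exists_reference_family`, the
registered sub-goal of this support file). [folklore] -/
theorem universalTwoPointMeasure_referenceFamily : ∃ (u : ℕ → SchwartzMap (EuclideanSpace ℝ (Fin 4)) ℂ) (m : ℝ), 0 < m ∧ (∀ (n : ℕ) (a : EuclideanSpace ℝ (Fin 4)), u n a ≠ 0 → ((n : ℝ) + 1)⁻¹ ≤ a 0) ∧ (∀ (n : ℕ) (p : EuclideanSpace ℝ (Fin 4)), 0 ≤ p 0 → ‖p‖ ≤ (n : ℝ) + 1 → m ≤ ((n : ℝ) + 1) ^ 4 * ‖∫ a : EuclideanSpace ℝ (Fin 4), u n a * Complex.exp (-((a 0 * p 0 : ℝ) : ℂ) + ((∑ j : Fin 3, a j.succ * p j.succ : ℝ) : ℂ) * Complex.I)‖) ∧ (∃ I₀ : ℝ, ∀ n : ℕ, ∫ a : EuclideanSpace ℝ (Fin 4), ‖u n a‖ ≤ I₀) ∧ (∀ s : Finset (ℕ × ℕ),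 ∃ (C : ℝ) (L : ℕ), ∀ n : ℕ, (s.sup (schwartzSeminormFamily ℂ (EuclideanSpace ℝ (Fin 4)) ℂ)) (u n) ≤ C * ((n : ℝ) + 1) ^ L) :=
  UniversalTwoPoint.exists_reference_family

end Summit.QuantumFields.YangMills.Theorems.NPointIsotropy.ComplexRotationBandlimit

end
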